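import Mathlib
import Literature.AlgebraicGeometry.Resolution.WeightedOrderIdealsIndexed
import Literature.AlgebraicGeometry.Resolution.RootAdjunctionRegular
import Literature.AlgebraicGeometry.Resolution.RegularSystemOfParameters
import HarnessLib

/-!
# Weighted quasi-regularity in ARBITRARY dimension: a `w`-form of weight `ρ` with `F(c) ∈ F^{(w)}_{ρ+1}` has coefficients in `𝔪`

Topic: `Literature/AlgebraicGeometry/Resolution`. Dimension-general form of `WeightedQuasiRegularGeneral.lean`
(`coeff_mem_maximalIdeal_of_weval_mem_general`, `c : Fin 3 → R`) — second brick of the generalisation `Fin 3 → Fin (r+2)` of the tree's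
expansion-free rendering of Hironaka's characteristic polyhedra (memo `run/shared/lean/pub/res-hironaka/L/res-L1-w42-stub-3/KEYCLAIM-PORT-PLAN.md`
§4; needed by Cossart–Jannsen–Saito's key theorem 6.40 for arbitrary embedding dimension). Setting: `R` a regular local ring of dimension `d`,
`c : Fin d → R` a regular system of parameters (`(c) = 𝔪`), positive integer weights `w : Fin d → ℕ`, and the weighted order ideals
`F^{(w)}_ρ = weightedOrderIdeal c w ρ` of `WeightedOrderIdealsIndexed.lean` (CJS Def. 7.2 (1), expansion-free).

* `exists_rootAdjunction_at` — ONE root adjunction at an index `j`: a regular local `B` of the same dimension, a local injective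
  `ι : R → B` and parameters `r` with `r_j^{d_j} = ι c_j`, `r_i = ι c_i` (`i ≠ j`), `(r) = 𝔪_B` (tree `AdjoinRoot.isRegularLocalRing_X_pow_sub_C`,
  Matsumura Thm. 14.2);
* `exists_rootAdjunction_all` — ALL roots: `S = R[r_i]/(r_i^{w_i} − c_i)` regular local of dimension `d`, `ι : R → S` local injective,
  `r_i^{w_i} = ι c_i`, `(r) = 𝔪_S` (the triple root adjunction `exists_rootAdjunction3` of the `Fin 3` file, by induction on the index);
* `coeff_mem_maximalIdeal_of_weval_mem_weightedOrderIdeal` — **weighted quasi-regularity**: if `F ∈ R[X_i]` is `w`-homogeneous of weight `ρ`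
  and `F(c) ∈ F^{(w)}_{ρ+1}`, then every coefficient of `F` lies in `𝔪` (in `S` the weighted monomials become honest monomials of degree
  `= weight` in the regular system of parameters `r`, and Matsumura 17.10 — tree `coeff_mem_maximalIdeal_of_eval_mem_pow` — applies).
  This is what makes the lowest-weight part of a unit presentation canonical, i.e. CJS's «`Δ(g, y, u)` does not depend on the presentation
  (7.3)» (Def. 8.2 (1), p0117) / the `L`-valuation `v_L` (Def. 7.2 (1)) expansion-free.

No named facts; no instance, notation or attribute. Everything proved; nothing about schemes.
-/

noncomputable section

open IsLocalRing MvPolynomial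

namespace Literature.AlgebraicGeometry.Resolution

universe u

variable {R : Type u} [CommRing R]

/-! ## Root adjunctions at one index, then at all indices -/

/-- **One root adjunction at the index `j`**: for a regular local `R` of dimension `n + 1` with regular system of parameters
`c : Fin (n+1) → R` and `d ≥ 1`, there is a regular local `B` of dimension `n + 1`, a local injective `ι : R → B` and `r : Fin (n+1) → B`
with `r_j^d = ι c_j`, `r_i = ι c_i` for `i ≠ j`, and `(r) = 𝔪_B` (namely `B = R[Z]/(Z^d − c_j)`). [cite: Matsumura1987, Thm. 14.2] -/
theorem exists_rootAdjunction_at [IsRegularLocalRing R] {n : ℕ} (c : Fin (n + 1) → R)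
    (hgen : Ideal.span (Set.range c) = maximalIdeal R) (hdim : ringKrullDim R = n + 1) (j : Fin (n + 1)) {d : ℕ}
    (hd : 0 < d) :
    ∃ (B : Type u) (_ : CommRing B) (_ : IsRegularLocalRing B) (ι : R →+* B) (r : Fin (n + 1) → B),
      IsLocalHom ι ∧ Function.Injective ι ∧ r j ^ d = ι (c j) ∧ (∀ i, i ≠ j → r i = ι (c i)) ∧
      Ideal.span (Set.range r) = maximalIdeal B ∧ ringKrullDim B = n + 1 := by
  classical
  -- the other parameters
  set x : Fin n → R := c ∘ j.succAbove with hx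
  have hgen1 : Ideal.span (insert (c j) (Set.range x)) = maximalIdeal R := by
    rw [← hgen, hx, Set.range_comp, Fin.range_succAbove, Set.insert_image_compl_eq_range]
  obtain ⟨hloc, hreg, hdim', hmax, hlh, hinj⟩ :=
    AdjoinRoot.isRegularLocalRing_X_pow_sub_C x (c j) hgen1 hdim hd
  haveI := hloc
  set g : Polynomial R := Polynomial.X ^ d - Polynomial.C (c j) with hg
  refine ⟨AdjoinRoot g, inferInstance, hreg, AdjoinRoot.of g, Function.update (AdjoinRoot.of g ∘ c) j (AdjoinRoot.root g),
    hlh, hinj, ?_, ?_, ?_, hdim'⟩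
  · rw [Function.update_self]
    have := AdjoinRoot.eval₂_root g
    rwa [hg, Polynomial.eval₂_sub, Polynomial.eval₂_X_pow, Polynomial.eval₂_C, sub_eq_zero] at this
  · intro i hi
    rw [Function.update_of_ne hi]; rfl
  · rw [hmax]
    apply le_antisymm
    · refine Ideal.span_le.mpr ?_
      rintro _ ⟨i, rfl⟩
      by_cases hi : i = j
      · subst hi
        rw [Function.update_self]
        exact Ideal.subset_span (Set.mem_insert _ _)
      · rw [Function.update_of_ne hi]
        obtain ⟨k, hk⟩ := Fin.exists_succAbove_eq hi
        refine Ideal.subset_span (Set.mem_insert_of_mem _ ⟨k, ?_⟩)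
        change AdjoinRoot.of g (c (j.succAbove k)) = AdjoinRoot.of g (c i)
        rw [hk]
    · refine Ideal.span_le.mpr ?_
      rintro b hb
      rcases Set.mem_insert_iff.mp hb with rfl | ⟨k, rfl⟩
      · refine Ideal.subset_span ⟨j, ?_⟩
        rw [Function.update_self]
      · refine Ideal.subset_span ⟨j.succAbove k, ?_⟩
        rw [Function.update_of_ne (Fin.succAbove_ne j k)]
        rfl

/-- Induction invariant for adjoining roots at the indices `< k`. [cite: Matsumura1987, Thm. 14.2] -/
theorem exists_rootAdjunction_lt [IsRegularLocalRing R] {n : ℕ} (c : Fin (n + 1) → R)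
    (hgen : Ideal.span (Set.range c) = maximalIdeal R) (hdim : ringKrullDim R = n + 1) (w : Fin (n + 1) → ℕ)
    (hw : ∀ i, 0 < w i) (k : ℕ) :
    ∃ (S : Type u) (_ : CommRing S) (_ : IsRegularLocalRing S) (ι : R →+* S) (r : Fin (n + 1) → S),
      IsLocalHom ι ∧ Function.Injective ι ∧ (∀ i : Fin (n + 1), (i : ℕ) < k → r i ^ w i = ι (c i)) ∧
      (∀ i : Fin (n + 1), k ≤ (i : ℕ) → r i = ι (c i)) ∧
      Ideal.span (Set.range r) = maximalIdeal S ∧ ringKrullDim S = n + 1 := by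
  induction k with
  | zero =>
    exact ⟨R, inferInstance, inferInstance, RingHom.id R, c, inferInstance, Function.injective_id,
      fun i hi => absurd hi (Nat.not_lt_zero _), fun i _ => rfl, hgen, hdim⟩
  | succ k ih =>
    obtain ⟨S, _, _, ι, r, hl, hi, hlt, hge, hspan, hdimS⟩ := ih
    haveI := hl
    by_cases hk : k < n + 1
    · -- adjoin a `w_j`-th root of `r_j`, `j = ⟨k, hk⟩`
      set j : Fin (n + 1) := ⟨k, hk⟩ with hj
      obtain ⟨B, _, _, ι', r', hl', hi', hroot, hother, hspan', hdimB⟩ :=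
        exists_rootAdjunction_at r hspan hdimS j (hw j)
      haveI := hl'
      refine ⟨B, inferInstance, inferInstance, ι'.comp ι, r', RingHom.isLocalHom_comp _ _, hi'.comp hi, ?_, ?_, hspan',
        hdimB⟩
      · intro i hik
        rcases Nat.lt_succ_iff_lt_or_eq.mp hik with hlt' | heq
        · have hij : i ≠ j := fun h => by rw [h, hj] at hlt'; exact lt_irrefl _ hlt'
          rw [hother i hij, ← map_pow, hlt i hlt']; rfl
        · have hij : i = j := Fin.ext heq
          subst hij
          rw [hroot, hge _ le_rfl]; rfl
      · intro i hik
        have hij : i ≠ j := fun h => by rw [h, hj] at hik; exact Nat.not_succ_le_self _ hik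
        rw [hother i hij, hge i (Nat.le_of_succ_le hik)]; rfl
    · -- nothing left to adjoin
      refine ⟨S, inferInstance, inferInstance, ι, r, hl, hi, fun i _ => hlt i ?_, fun i hik => ?_, hspan, hdimS⟩
      · exact lt_of_lt_of_le i.isLt (not_lt.mp hk)
      · exact absurd (lt_of_lt_of_le i.isLt ((not_lt.mp hk).trans (Nat.le_of_succ_le hik))) (lt_irrefl _)

/-- **All root adjunctions** `S = R[r_0, …, r_n]/(r_i^{w_i} − c_i)`: a regular local ring of the same dimension with regular system of
parameters `(r_i)`, `r_i^{w_i} = ι c_i`, `ι : R → S` local and injective (the `Fin 3` file's `exists_rootAdjunction3`, any dimension).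
[cite: Hironaka1967, §1] [cite: Matsumura1987, Thm. 14.2] -/
theorem exists_rootAdjunction_all [IsRegularLocalRing R] {n : ℕ} (c : Fin (n + 1) → R)
    (hgen : Ideal.span (Set.range c) = maximalIdeal R) (hdim : ringKrullDim R = n + 1) (w : Fin (n + 1) → ℕ)
    (hw : ∀ i, 0 < w i) :
    ∃ (S : Type u) (_ : CommRing S) (_ : IsRegularLocalRing S) (ι : R →+* S) (r : Fin (n + 1) → S),
      IsLocalHom ι ∧ Function.Injective ι ∧ (∀ i, r i ^ w i = ι (c i)) ∧
      Ideal.span (Set.range r) = maximalIdeal S ∧ ringKrullDim S = n + 1 := by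
  obtain ⟨S, _, _, ι, r, hl, hi, hlt, -, hspan, hdimS⟩ := exists_rootAdjunction_lt c hgen hdim w hw (n + 1)
  exact ⟨S, inferInstance, inferInstance, ι, r, hl, hi, fun i => hlt i i.isLt, hspan, hdimS⟩

/-! ## Weighted quasi-regularity -/

/-- The exponent map `e ↦ (w_i e_i)_i`. [cite: Hironaka1967, §1] -/
def wstretch {n : ℕ} (w : Fin n → ℕ) (e : Fin n →₀ ℕ) : Fin n →₀ ℕ :=
  Finsupp.equivFunOnFinite.symm fun i => w i * e i

/-- Components of `wstretch`. [cite: Hironaka1967, §1] -/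
theorem wstretch_apply {n : ℕ} (w : Fin n → ℕ) (e : Fin n →₀ ℕ) (i : Fin n) : wstretch w e i = w i * e i := rfl

/-- `wstretch` is injective for positive weights. [cite: Hironaka1967, §1] -/
theorem wstretch_injective {n : ℕ} {w : Fin n → ℕ} (hw : ∀ i, 0 < w i) : Function.Injective (wstretch w) := by
  intro e e' h
  ext i
  have := congrArg (fun m : Fin n →₀ ℕ => m i) h
  simp only [wstretch_apply] at this
  exact Nat.eq_of_mul_eq_mul_left (hw i) this

/-- The degree of `wstretch w e` is the weight of `e`. [cite: Hironaka1967, §1] -/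
theorem degree_wstretch {n : ℕ} (w : Fin n → ℕ) (e : Fin n →₀ ℕ) : (wstretch w e).degree = Finsupp.weight w e := by
  rw [Finsupp.degree_eq_weight_one]
  change Finsupp.weight (fun _ => 1) (wstretch w e) = _
  rw [Finsupp.weight_apply, Finsupp.weight_apply, Finsupp.sum_fintype _ _ (by simp), Finsupp.sum_fintype _ _ (by simp)]
  exact Finset.sum_congr rfl fun i _ => by simp [wstretch_apply, mul_comm]

/-- In the root adjunction, weighted monomials become honest monomials: `ι(c^e) = r^{wstretch w e}`. [cite: Hironaka1967, §1] -/
theorem map_cmonom_eq_cmonom_wstretch {S : Type u} [CommRing S] (ι : R →+* S) {n : ℕ} (c : Fin n → R) (r : Fin n → S)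
    (w : Fin n → ℕ) (hr : ∀ i, r i ^ w i = ι (c i)) (e : Fin n →₀ ℕ) :
    ι (cmonom c e) = cmonom r (wstretch w e) := by
  rw [cmonom_eq_prod, cmonom_eq_prod, map_prod]
  exact Finset.prod_congr rfl fun i _ => by rw [map_pow, ← hr i, ← pow_mul, wstretch_apply]

/-- **Weighted quasi-regularity for positive integer weights, any dimension**: if `F ∈ R[X_0, …, X_n]` is `w`-homogeneous of weight `ρ`
and `F(c) ∈ F^{(w)}_{ρ+1}`, then every coefficient of `F` lies in `𝔪` (Matsumura 17.10 in the root adjunction `S`). Dimension-general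
form of `coeff_mem_maximalIdeal_of_weval_mem_general`. [cite: Hironaka1967, §1] [cite: Matsumura1987, Thm. 17.10] -/
theorem coeff_mem_maximalIdeal_of_weval_mem_weightedOrderIdeal [IsRegularLocalRing R] {n : ℕ} (c : Fin (n + 1) → R)
    (hgen : Ideal.span (Set.range c) = maximalIdeal R) (hdim : ringKrullDim R = n + 1)
    (w : Fin (n + 1) → ℕ) (hw : ∀ i, 0 < w i) {ρ : ℕ} {F : MvPolynomial (Fin (n + 1)) R}
    (hF : ∀ m ∈ F.support, Finsupp.weight w m = ρ)
    (h : eval c F ∈ weightedOrderIdeal c w (ρ + 1)) (m : Fin (n + 1) →₀ ℕ) :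
    F.coeff m ∈ maximalIdeal R := by
  classical
  by_cases hm : m ∈ F.support
  swap
  · rw [notMem_support_iff.mp hm]; exact Ideal.zero_mem _
  obtain ⟨S, _, _, ι, r, hιloc, -, hr, hgenS, hdimS⟩ := exists_rootAdjunction_all c hgen hdim w hw
  haveI := hιloc
  -- the stretched form
  set G : MvPolynomial (Fin (n + 1)) S := ∑ e ∈ F.support, monomial (wstretch w e) (ι (F.coeff e)) with hG
  have hGcoeff : ∀ e ∈ F.support, G.coeff (wstretch w e) = ι (F.coeff e) := by
    intro e he
    rw [hG, coeff_sum, Finset.sum_eq_single e]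
    · rw [coeff_monomial, if_pos rfl]
    · intro e' _ hne
      rw [coeff_monomial, if_neg]
      exact fun h' => hne (wstretch_injective hw h')
    · intro he'; exact absurd he he'
  have hGhom : G.IsHomogeneous ρ := by
    rw [hG]
    refine IsHomogeneous.sum _ _ _ fun e he => ?_
    refine isHomogeneous_monomial _ ?_
    rw [degree_wstretch, hF e he]
  -- `G(r) = ι (F(c))`
  have hGeval : eval r G = ι (eval c F) := by
    conv_rhs => rw [F.as_sum, map_sum, map_sum]
    rw [hG, map_sum]
    refine Finset.sum_congr rfl fun e _ => ?_
    rw [eval_monomial_eq_cmonom, eval_monomial_eq_cmonom, map_mul, map_cmonom_eq_cmonom_wstretch ι c r w hr]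
  -- `ι(F_{ρ+1}) ⊆ 𝔫^{ρ+1}`
  have hrm : ∀ i, r i ∈ maximalIdeal S := fun i => hgenS ▸ Ideal.subset_span ⟨i, rfl⟩
  have hFle : (weightedOrderIdeal c w (ρ + 1)).map ι ≤ maximalIdeal S ^ (ρ + 1) := by
    rw [weightedOrderIdeal, Ideal.map_span]
    refine Ideal.span_le.mpr ?_
    rintro _ ⟨_, ⟨e, he, rfl⟩, rfl⟩
    rw [SetLike.mem_coe, map_cmonom_eq_cmonom_wstretch ι c r w hr]
    refine Ideal.pow_le_pow_right ?_ (cmonom_mem_pow_degree r (maximalIdeal S) hrm (wstretch w e))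
    rw [degree_wstretch]; exact he
  have hGmem : eval r G ∈ maximalIdeal S ^ (ρ + 1) := by
    rw [hGeval]; exact hFle (Ideal.mem_map_of_mem _ h)
  -- Matsumura 17.10 in `S`
  have hfr : (maximalIdeal S).spanFinrank = n + 1 := by
    have := (isRegularLocalRing_iff S).mp inferInstance
    rw [hdimS] at this
    exact_mod_cast this
  have hc := coeff_mem_maximalIdeal_of_eval_mem_pow hfr r hgenS hGhom hGmem (wstretch w m)
  rw [hGcoeff m hm] at hc
  by_contra hcm
  have hunit : IsUnit (F.coeff m) := by
    by_contra h'; exact hcm ((IsLocalRing.mem_maximalIdeal _).mpr h')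
  exact (IsLocalRing.mem_maximalIdeal _).mp hc (hunit.map ι)

end Literature.AlgebraicGeometry.Resolution

end
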